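import Mathlib.Data.ZMod.Basic
import Mathlib.Algebra.Polynomial.Degree.Defs
import Literature.Computability.Complexity.ArthurMerlinParallelPlay
import Literature.Computability.Complexity.StackUnaryBits
import HarnessLib

/-!
# Reading the moves of the `IP = PSPACE` game: field elements and polynomials over `𝔽_p` from bit strings

The Shamir–Shen game of `ShenProtocolGame.lean` is abstract in two parsers: Arthur's move `z ∈ {0,1}^m`
is read as a field element `parseR z` and Merlin's move `y ∈ {0,1}^m` as a univariate polynomial
`parseS y` of degree `≤ d`; soundness needs a bound `κ` on the number of moves read as any fixed field
element, completeness needs every polynomial of degree `≤ d` to be the reading of some move. Over the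
prime field `𝔽_p` (Arora–Barak §8.3.2: "All computations … are done in the field `𝔽 = 𝔽_p`"; "pick a
random number `a` in `GF(p)`") this file fixes the two readings and proves exactly those hypotheses:

* `ShenGame.fieldOfBits p z = (z as a little-endian number) mod p`, and
  **`ShenGame.card_filter_fieldOfBits_le`**: at most `2^m / p + 1` strings of length `m` read as any
  given element (the multiples-of-`p` count; so Arthur's `a` is uniform up to `1/p + 2^{-m}` per element
  — the printed protocol draws `a ∈ GF(p)` exactly uniformly, the bit-string model pays this rounding);
* `ShenGame.polyOfBits p β d y = Σ_{i ≤ d} (block i of width β, as a number mod p) Xⁱ` —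
  "the prover sends a polynomial of degree `d`" as `d + 1` fixed-width coefficients;
  `natDegree_polyOfBits_le` (`≤ d` on EVERY string, so a cheating prover cannot raise the degree) and
  **`ShenGame.exists_polyOfBits_eq`**: if `p ≤ 2^β` and `(d+1)·β ≤ m`, every polynomial of degree `≤ d`
  is read off some `y ∈ {0,1}^m` (blocks `natBits β (coeffᵢ.val)`, `isBoardSplit_block_of_le`).

All proved, no named facts; `bitsToNat`/`natBits`/`block` are the tree's.

## References

* S. Arora, B. Barak, *Computational Complexity: A Modern Approach*, CUP 2009, §8.3.2–8.3.3 (the field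
  `𝔽_p`, the random `a ∈ GF(p)`, "a degree `d` polynomial `s(X₁)`"), PDF pp. 192–195.
-/

noncomputable section

namespace Literature.Computability.Complexity

open Finset Polynomial

open scoped Classical

namespace ShenGame

/-! ### Arthur's move as a field element -/

/-- **Arthur's random field element**: the move read as a little-endian number, reduced mod `p`.
[cite: AroraBarakCC2009, §8.3.2 ("pick a random number `a` in GF(p)")] -/
def fieldOfBits (p : ℕ) (z : List Bool) : ZMod p :=
  (bitsToNat z : ZMod p)

/-- `bitsToNat` is injective on strings of a fixed length (both are `natBits` of their value). [folklore] -/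
theorem natBits_length_bitsToNat : ∀ l : List Bool, natBits l.length (bitsToNat l) = l
  | [] => rfl
  | b :: l => by
    rw [List.length_cons, natBits, bitsToNat_cons]
    have h1 : (b.toNat + 2 * bitsToNat l) % 2 = b.toNat := by
      cases b <;> simp only [Bool.toNat_false, Bool.toNat_true] <;> omega
    have h2 : (b.toNat + 2 * bitsToNat l) / 2 = bitsToNat l := by
      cases b <;> simp only [Bool.toNat_false, Bool.toNat_true] <;> omega
    rw [h1, h2, natBits_length_bitsToNat l]
    cases b <;> simp

/-- **Numbers below `M` with a given residue mod `p` are at most `M / p + 1`.** [folklore] -/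
theorem card_filter_range_mod_eq_le (M p r : ℕ) :
    ((range M).filter fun n => n % p = r).card ≤ M / p + 1 := by
  have hinj : Set.InjOn (fun n => n / p) ((range M).filter fun n => n % p = r : Finset ℕ) := by
    intro a ha b hb hab
    simp only [coe_filter, Set.mem_setOf_eq, mem_range] at ha hb
    simp only at hab
    rw [← Nat.div_add_mod a p, ← Nat.div_add_mod b p, hab, ha.2, hb.2]
  have hmaps : ∀ n ∈ (range M).filter (fun n => n % p = r), n / p ∈ range (M / p + 1) := by
    intro n hn
    rw [mem_filter, mem_range] at hn
    rw [mem_range, Nat.lt_succ_iff]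
    exact Nat.div_le_div_right hn.1.le
  calc ((range M).filter fun n => n % p = r).card
      ≤ (range (M / p + 1)).card := card_le_card_of_injOn _ hmaps hinj
    _ = M / p + 1 := card_range _

/-- **At most `2^m / p + 1` of Arthur's `2^m` moves are read as any given field element.**
[cite: AroraBarakCC2009, §8.3.2 ("pick a random number `a` in GF(p)")] -/
theorem card_filter_fieldOfBits_le (p m : ℕ) (a : ZMod p) :
    ((univ.filter fun z : List.Vector Bool m => fieldOfBits p z.toList = a).card : ℝ) ≤ (2 : ℝ) ^ m / p + 1 := by
  -- inject the moves into the numbers below `2^m` with residue `a.val`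
  have hinj : Set.InjOn (fun z : List.Vector Bool m => bitsToNat z.toList)
      (univ.filter fun z : List.Vector Bool m => fieldOfBits p z.toList = a : Finset _) := by
    intro z _ w _ h
    apply List.Vector.toList_injective
    have hz := natBits_length_bitsToNat z.toList
    have hw := natBits_length_bitsToNat w.toList
    rw [List.Vector.toList_length] at hz hw
    rw [← hz, ← hw]
    exact congrArg (natBits m) h
  have hmaps : ∀ z ∈ univ.filter (fun z : List.Vector Bool m => fieldOfBits p z.toList = a),
      bitsToNat z.toList ∈ (range (2 ^ m)).filter fun n => n % p = a.val := by
    intro z hz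
    rw [mem_filter] at hz ⊢
    refine ⟨mem_range.2 (by simpa using bitsToNat_lt z.toList), ?_⟩
    have h := hz.2
    rw [fieldOfBits] at h
    rw [← ZMod.val_natCast, h]
  have hnat : (univ.filter fun z : List.Vector Bool m => fieldOfBits p z.toList = a).card ≤ 2 ^ m / p + 1 :=
    (card_le_card_of_injOn _ hmaps hinj).trans (card_filter_range_mod_eq_le _ _ _)
  have hdiv : (((2 ^ m / p : ℕ) : ℝ)) ≤ (2 : ℝ) ^ m / p := by
    have h : (((2 ^ m / p : ℕ) : ℝ)) ≤ ((2 ^ m : ℕ) : ℝ) / (p : ℝ) := Nat.cast_div_le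
    push_cast at h
    exact h
  calc ((univ.filter fun z : List.Vector Bool m => fieldOfBits p z.toList = a).card : ℝ)
      ≤ ((2 ^ m / p + 1 : ℕ) : ℝ) := by exact_mod_cast hnat
    _ ≤ (2 : ℝ) ^ m / p + 1 := by push_cast; linarith

/-! ### Merlin's move as a polynomial of degree `≤ d` -/

/-- **Merlin's polynomial**: `d + 1` coefficients, coefficient `i` read off block `i` of width `β` of the
move as a number mod `p`. [cite: AroraBarakCC2009, §8.3.3 ("The prover provides a degree `d` polynomial `s(X₁)`")] -/
def polyOfBits (p β d : ℕ) (y : List Bool) : Polynomial (ZMod p) :=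
  ∑ i ∈ range (d + 1), C (bitsToNat (block β i y) : ZMod p) * X ^ i

/-- **Whatever Merlin sends is read as a polynomial of degree `≤ d`.** [cite: AroraBarakCC2009, §8.3.3] -/
theorem natDegree_polyOfBits_le (p β d : ℕ) (y : List Bool) : (polyOfBits p β d y).natDegree ≤ d := by
  unfold polyOfBits
  refine natDegree_sum_le_of_forall_le _ _ fun i hi => ?_
  exact (natDegree_C_mul_X_pow_le _ _).trans (Nat.lt_succ_iff.1 (mem_range.1 hi))

/-- **Every polynomial of degree `≤ d` over `𝔽_p` is the reading of some move** of length `m`, provided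
a block holds a residue (`p ≤ 2^β`) and the move holds `d + 1` blocks (`(d+1)·β ≤ m`): write the
coefficients in binary, block by block. [cite: AroraBarakCC2009, §8.3.3] -/
theorem exists_polyOfBits_eq {p β d m : ℕ} (hp : 0 < p) (hpβ : p ≤ 2 ^ β) (hm : (d + 1) * β ≤ m)
    (s : Polynomial (ZMod p)) (hs : s.natDegree ≤ d) :
    ∃ y : List.Vector Bool m, polyOfBits p β d y.toList = s := by
  haveI : NeZero p := ⟨hp.ne'⟩
  -- the coefficient blocks
  set b : Fin (d + 1) → List.Vector Bool β := fun i => ⟨natBits β (s.coeff i).val, length_natBits _ _⟩ with hb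
  obtain ⟨W, hW⟩ := (isBoardSplit_block_of_le hm).surj b
  refine ⟨W, ?_⟩
  have hblock : ∀ i ∈ range (d + 1), (bitsToNat (block β i W.toList) : ZMod p) = s.coeff i := by
    intro i hi
    have h := hW ⟨i, mem_range.1 hi⟩
    rw [h]
    change ((bitsToNat (natBits β (s.coeff i).val) : ℕ) : ZMod p) = s.coeff i
    rw [bitsToNat_natBits ((ZMod.val_lt _).trans_le hpβ), ZMod.natCast_zmod_val]
  unfold polyOfBits
  rw [sum_congr rfl fun i hi => by rw [hblock i hi]]
  simp_rw [C_mul_X_pow_eq_monomial]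
  exact (as_sum_range' s (d + 1) (Nat.lt_succ_of_le hs)).symm

end ShenGame

end Literature.Computability.Complexity

end
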